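import Summits.Schanuel.Schanuel.Theorems.RootDecomp1BHyperFrame05
import Summits.Schanuel.Schanuel.Theorems.RootDecomp1BMovingZero01
import Summits.Schanuel.Schanuel.Theorems.RootDecomp1KHyper42

/-!
# RootDecomp1BQuadFrame — lens 4, generation 36 ADDENDUM «QUADRATIC FRAMES» (B-R23 (ii)(b)): the (1|ρ) At-cells and 5 ≤ polarDeg (1, ρ) for EVERY ρ ∈ `QuadHyperLiouville` (hyper-approximable by real quadratic irrationals) modulo `Roy2014_thm_1_1` ONLY, with the NAMED member ρ_Q = √2 + λ_H of FINITE irrationality exponent — part 1 (RootDecomp1BQuadFrame01): §Q quadratic bookkeeping + §U the norm-form clearing of the first variable at a quadratic point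

PORT NOTE (census-1 gen 17, 2026-08-31): port of [HOME/decomp-schanuel-lens-4/g36/QuadFrame.lean sha256 ffb0c3af…, 1516 l, imports tree HyperFrame05 + MovingZero01 + Hyper42 + QuadFrameProbe 8fe8f638… + QuadFrameCtrl bdc3d890… (rc 1 at exactly 9 planted lines) + NODE-quad.md 0c4a4cf6…; CLAIM L1911, crit g8 RULING L1921 (checklist B-g36Q), NODE L1950 / REQUEST L1951 / RESULT L1952, critic VERDICT L1957 (crit g8: CLEARED — B-R23 (ii)(b) ONE CELL CREDIT AWARDED to lens-4 (tally THEOREM ×2 + CELL ×2); checklist B-g36Q (1)–(7) PASS; label VARIANT-REACH/«not new-mechanism»; RULE B-R24: the bounded-degree frame line CLOSED for re-parametrisation; PORT GO)]; own farm rc 0 · 0 warn · 0 sorry · axioms std.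
Split in five parts for the 400-line cap: 01 = §Q quadratic bookkeeping (`useq`/`vseq`, the twisted powers γ^k = u_k + v_k γ) + §U the NORM-FORM CLEARING `Q = U² − bUV + acV²` of the first variable at a quadratic point; 02 = §D the frame point `qpt β = (1, β, i, iβ)`, the class `QuadHyperLiouville`, the measure `QuadFrameMeasure` + §R `quadFrameMeasure_of_roy : Roy2014_thm_1_1 → QuadFrameMeasure` (Roy at t = 4 along the VARYING field ℚ(β) ⊔ ℚ(i), degree ≤ 4 uniformly; `maxHeartbeats 800000 in` carried); 03 = §E THE ENGINE `algebraicIndependent_cons_of_quadFrameMeasure` (`maxHeartbeats 1600000 in` carried); 04 = §M the NAMED MEMBER ρ_Q = √2 + λ_H: `quadHyperLiouville_rhoQ`, `rhoQ_finite_exponent` (|ρ_Q − p/q| ≥ 1/(64000 q^10)), `not_liouville_rhoQ`, `rhoQ_separation`; 05 = §C THE CELLS at (1|ρ) for ρ ∈ QuadHyperLiouville mod hRoy (`five_le_polarDeg_one_of_quadHyper`, X(2) both orderings, the At-cells `sharpRelativeLindemannAt_one_quad` / `tameDefectZeroAt_one_quad` / `wildSharpDefectZeroAt_one_quad` / `…Init…`)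 + §N the cells at ρ_Q.
PORT EDITS: the axiom-audit block (9 `#guard_msgs in #print axioms`) dropped; thirteen one-line docstrings; statements and proofs verbatim; `hRoy : Roy2014_thm_1_1` stays a binder BY NAME (tree fact, RootDecomp1EPointTransfer01); the LIVE-item `Iff.rfl` probes stay in the HOME probe (no Theses import here). `--supports stmt-Schanuel-32406` (the At-cells of 32407 / 32408 ride in part 05: `tameDefectZeroAt_one_quad` / `wildSharpDefectZeroAt_one_quad` / `wildSharpDefectZeroInitAt_one_quad` and their `…_rhoQ` instances); no census credit carried; nothing here proves Schanuel or 32406; rung 0. The lens's header follows.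
-/

/-!
# RootDecomp1BQuadFrame — lens 4, generation 36, addendum «QUADRATIC FRAMES» (B-R23 (ii)(b))

**STATUS: PROVED modulo the ONE tree fact `Roy2014_thm_1_1` (Roy 2013, Thm 1.1 — the point-explicit
Lindemann–Weierstrass measure, already a cited `def : Prop` of `RootDecomp1EPointTransfer`; NO new `def : Prop`,
fact budget untouched).  0 `sorry`; axioms `propext, Classical.choice, Quot.sound` (guards at the end).**

## What is proved

For every real `ρ` in the class `QuadHyperLiouville` (below),
* `five_le_polarDeg_one_of_quadHyper : Roy2014_thm_1_1 → QuadHyperLiouville ρ → 5 ≤ polarDeg ![1, ρ]` — the FULL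
  Schanuel value of the column `(1 | ρ)`: `ρ, e, e^ρ, e^i, e^{iρ}` are algebraically independent over `ℚ`
  (`algebraicIndependent_cons_of_quadFrameMeasure` + `quadFrameMeasure_of_roy`); the same for `(ρ | 1)`;
* hence the storey-2 floor **X(2)(1, ρ)** `(2+2 : ℕ) ≤ polarDeg ![1, ρ]` (`four_le_polarDeg_one_of_quadHyper`, and
  VERBATIM in the `KleinPolarSchanuel`-body shape `kleinPolarSchanuel_body_two_one_quad`), and the At-cells of the
  items 32406 / 32407 / 32408 at `(1 | ρ)`: `sharpRelativeLindemannAt_one_quad`, `tameDefectZeroAt_one_quad`,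
  `wildSharpDefectZeroAt_one_quad`, `wildSharpDefectZeroInitAt_one_quad`;
* **a NAMED MEMBER with FINITE irrationality exponent** (§M, §N — hypothesis-free): `rhoQ := √2 + λ_H`
  (`λ_H = Σ_k 2^{−a_k}`, `a₀ = 1`, `a_{k+1} = 2^{(k+1)a_k}`, the tree's `HyperCell.lambdaH`) satisfies
  `quadHyperLiouville_rhoQ : QuadHyperLiouville rhoQ` (frames `β_K = √2 + M_K/2^{a_K}`) AND
  `abs_rhoQ_sub_rat_ge_pow : 0 < q → 1/(64000·q¹⁰) ≤ |rhoQ − p/q|` (so `rhoQ_finite_exponent`,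
  `not_liouville_rhoQ : ¬ Liouville rhoQ`, and `rhoQ_separation`: `rhoQ` is in NONE of `HyperLiouville`,
  `LiouvilleOrder k` (`k ≥ 3`), `UltraLiouville` — the classes of every earlier `(1|ρ)`-cell); hence, mod Roy only,
  `five_le_polarDeg_one_rhoQ : Roy2014_thm_1_1 → 5 ≤ polarDeg ![1, rhoQ]` (`algebraicIndependent_rhoQ`:
  `ρ_Q, e, e^{ρ_Q}, e^i, e^{iρ_Q}` algebraically independent) and the X(2) / At-cells at `(1 | ρ_Q)`.
  The finite-exponent proof is the effective measure `|√2 − u/v| ≥ 1/(5v²)` (`sqrt_two_sub_rat_ge`) applied to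
  `u/v = p/q − M_K/2^{a_K}` at the scale `2^{a_K} ≤ 2q < 2^{a_{K+1}}` (`exists_scale`), in two regimes separated by
  `20q²4^{a_K} ≶ 2^{a_{K+1}}`, with the tower growth `20·(2^{a_{K+1}})⁴ ≤ 2^{a_{K+2}}` (`hexp_growth`).

## The class — a NEW INPUT TYPE (critic's rule B-R23 (ii)(b))

`QuadHyperLiouville ρ :≡ ∀ m, ∃ β a b c A, m ≤ A ∧ β ∉ ℚ ∧ a ≠ 0 ∧ aβ² + bβ + c = 0 ∧ |a|,|b|,|c| ≤ A ∧ β ≠ ρ ∧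
|ρ − β| < exp(−A^m)`: `ρ` is HYPER-well approximated by real QUADRATIC irrationals (Koksma's `w₂*` in the «hyper»
normalisation of the lens-4 classes).  Every previous (1|ρ)-cell of the cell (HyperFrame g32–g34, MovingZero
g35–g36, the 1K `HyperLiouville` / `LiouvilleOrder k` cells) lives on a RATIONAL approximation regime
`|ρ − p/q| < e^{−q^m}` resp. `q^{−k}`; the present class is not reachable by any of them: the Maillet–Baker
quasi-periodic continued fractions `ξ = lim Vₙ`, `Vₙ₊₁ = Vₙ^{tₙ} 2`, `tₙ ≥ 3^{n|Vₙ|}`, have ALL partial quotients in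
`{1, 2}` — so `|ξ − p/q| > 1/(4q²)` for every rational, irrationality exponent exactly `2`, outside EVERY rational
regime beyond Dirichlet — and lie in `QuadHyperLiouville` (`αₙ = [0; Vₙ^∞]` is a quadratic irrational of height
`≤ q_{|Vₙ|}` with `|ξ − αₙ| < q_{tₙ|Vₙ|}^{−2}`; Baker 1962, Mathematika 9, doi:10.1112/s002557930000303x, in the form of
Adamczewski–Bugeaud, JEMS 12 (2010), Lemma 7.1, p. 894 [corpus: paper:doi-10-4171-jems-218 p.12]).  (This
continued-fraction remark is classical bookkeeping and is NOT formalised here; non-emptiness — indeed a member of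
irrationality exponent `≤ 10` — IS formalised in §M with the explicit number `rhoQ = √2 + λ_H`.)

## The mechanism — why quadratic approximants work where rational ones cannot

The HyperFrame engine (g32) transfers a measure at the MOVING Lindemann–Weierstrass point `α_r = (1, r, i, ir)`,
`r → ρ`; at `(1 | ρ)` this is DEAD for rational `r` — `(1, r, i, ir)` is not ℚ-free (the (L−) wall
`not_linearIndependent_one_I_rat` of HyperFrame05), so no L–W measure exists there.  For a quadratic irrational
`β` the point `α_β = (1, β, i, iβ)` IS ℚ-free (`linearIndependent_qpt`), the number field `K_β = ℚ(β, i)` VARIES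
with `β` but has degree `≤ 4`, house `≤ 2A` (`norm_quadRoot_le`) and denominator `a² ≤ A²` UNIFORMLY in the naive
height `A` — and Roy's bound sees the point only through these three numbers: `quadFrameMeasure_of_roy` gives the
UNIFORM measure `QuadFrameMeasure` (`|P(e^{α_β})| ≥ exp(−C(log H + A^N))`).  The first variable is then cleared
not by `q^d P(p/q, X)` but by the NORM FORM of `ℚ(aβ)/ℚ`:
`Q_β = U² − bUV + acV² = (U + aβ·V)(U + aβ′·V) ∈ ℤ[X₁..X₄]`, where `a^d P(β, X) = U(X) + aβ·V(X)` via
`(aβ)^k = u_k + v_k·(aβ)` (§Q, §U); `Q_β ≠ 0` by the irrationality of `aβ, aβ′` coefficientwise and the grouped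
coefficient `g(β) ≠ 0` near `ρ`; its height is `≤ 3A²·len(P)²·(2A²)^{2d}` and
`|Q_β(e^{α_β})| ≤ A^d·Kl·e^{−A^m} · 3A(|ρ|+1)·len(P)·(2A²)^d·e^{d(|ρ|+1)}` — `e^{−A^m}` beats `exp(−C(log H + A^N))`
(`engine_endgame` of HyperFrame02).  Mahler's argument thus yields the algebraic independence of
`ρ, e, e^ρ, e^i, e^{iρ}`, i.e. `t(1, ρ) = 5`.

Declared non-claims: nothing here bears on `MovingZeroApprox`, on the four `def : Prop` inputs of g35/g36, or on
the summit; `Roy2014_thm_1_1` stays a hypothesis of every cell.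
-/

noncomputable section

open Complex IntermediateField MvPolynomial

namespace Summit.Schanuel.Schanuel.Theorems.RootDecomp1BQuadFrame

open Summit.Schanuel.Schanuel.Theorems.RootDecomp1EPointTransfer (Roy2014_thm_1_1)
open Summit.Schanuel.Schanuel.Theorems.RootDecomp1KHyper (mvlen mvlen_nonneg abs_coeff_le_mvlen one_le_mvlen
  exists_ball_eval_ne_zero mvlen_add_le mvlen_sub_le mvlen_mul_le mvlen_C_mul_le mvlen_sum_le)
open Summit.Schanuel.Schanuel.Theorems.RootDecomp1BHyperFrame (royDeg royS RoyNF roy_tree_iff framePt Ff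
  Ff_eq_aeval exists_lipschitz_Ff gcoef gcoef_ne_zero apply_zero_le_totalDegree engine_endgame
  trdeg_adjoin_le_of_isAlgebraic' linearIndependent_one_irrational)
open Summit.Schanuel.Schanuel.Theorems.RootDecomp1BFedFlagCore (KleinIH polarDeg polarField)
open Summit.Schanuel.Schanuel.Theorems.RootDecomp1BDefectFloorDefs (SharpRelativeLindemannAt TameDefectZeroAt
  WildSharpDefectZeroAt WildSharpDefectZeroInitAt WildSharpInitAt)
open Summit.Schanuel.Schanuel.Theorems.RootDecomp1BDefectFloorCells (natCast_le_trdeg_of_algebraicIndependent)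
open Summit.Schanuel.Schanuel.Theorems.RootDecomp1BRadicalDescent (exists_int_relation norm_mvaeval_le_mvlen)
open Summit.Schanuel.Schanuel.Theorems.RootDecomp1BMovingZero (mem_polarField_one mem_polarField_swap)

/-! ## §Q  Quadratic bookkeeping: the twisted power sequences `γ^k = u_k + v_k γ` -/

section Quad

variable (a b c : ℤ)

/-- `(u_k, v_k)` with `γ^k = u_k + v_k γ` for every root `γ` of `Z² + bZ + ac`. -/
def uv : ℕ → ℤ × ℤ
  | 0 => (1, 0)
  | k + 1 => (-(a * c) * (uv k).2, (uv k).1 - b * (uv k).2)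

/-- `u_k` -/
def useq (k : ℕ) : ℤ := (uv a b c k).1

/-- `v_k` -/
def vseq (k : ℕ) : ℤ := (uv a b c k).2

/-- `u_0 = 1`. -/
@[simp] theorem useq_zero : useq a b c 0 = 1 := rfl
/-- `v_0 = 0`. -/
@[simp] theorem vseq_zero : vseq a b c 0 = 0 := rfl
/-- Recursion for `u_{k+1}`. -/
theorem useq_succ (k : ℕ) : useq a b c (k + 1) = -(a * c) * vseq a b c k := rfl
/-- Recursion for `v_{k+1}`. -/
theorem vseq_succ (k : ℕ) : vseq a b c (k + 1) = useq a b c k - b * vseq a b c k := rfl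

/-- `γ^k = u_k + v_k γ` for every `γ` with `γ² + bγ + ac = 0` (any commutative ring). -/
theorem pow_eq_uv {R : Type*} [CommRing R] (γ : R)
    (hγ : γ ^ 2 + (b : R) * γ + (a : R) * (c : R) = 0) (k : ℕ) :
    γ ^ k = (useq a b c k : R) + (vseq a b c k : R) * γ := by
  induction k with
  | zero => simp
  | succ k ih =>
    rw [pow_succ, ih, useq_succ, vseq_succ]
    push_cast
    linear_combination (vseq a b c k : R) * hγ

/-- the size of `u_k, v_k`: both are `≤ (2A²)^k` in absolute value when `|a|, |b|, |c| ≤ A`, `A ≥ 1` -/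
theorem abs_uv_le {A : ℤ} (hA : 1 ≤ A) (ha : |a| ≤ A) (hb : |b| ≤ A) (hc : |c| ≤ A) (k : ℕ) :
    |useq a b c k| ≤ (2 * A * A) ^ k ∧ |vseq a b c k| ≤ (2 * A * A) ^ k := by
  induction k with
  | zero => simp
  | succ k ih =>
    obtain ⟨hu, hv⟩ := ih
    have hW : (0 : ℤ) ≤ (2 * A * A) ^ k := pow_nonneg (by nlinarith) k
    have ha0 := abs_nonneg a
    have hb0 := abs_nonneg b
    have hc0 := abs_nonneg c
    have hAA : A * A ≤ 2 * A * A := by nlinarith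
    have h1A : 1 + A ≤ 2 * A * A := by nlinarith
    refine ⟨?_, ?_⟩
    · rw [useq_succ, abs_mul, abs_neg, abs_mul, pow_succ]
      calc |a| * |c| * |vseq a b c k| ≤ A * A * (2 * A * A) ^ k := by gcongr
        _ ≤ (2 * A * A) * (2 * A * A) ^ k := mul_le_mul_of_nonneg_right hAA hW
        _ = (2 * A * A) ^ k * (2 * A * A) := mul_comm _ _
    · rw [vseq_succ, pow_succ]
      calc |useq a b c k - b * vseq a b c k| ≤ |useq a b c k| + |b * vseq a b c k| := abs_sub _ _
        _ = |useq a b c k| + |b| * |vseq a b c k| := by rw [abs_mul]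
        _ ≤ (2 * A * A) ^ k + A * (2 * A * A) ^ k := by gcongr
        _ = (1 + A) * (2 * A * A) ^ k := by ring
        _ ≤ (2 * A * A) * (2 * A * A) ^ k := mul_le_mul_of_nonneg_right h1A hW
        _ = (2 * A * A) ^ k * (2 * A * A) := mul_comm _ _

end Quad

/-! ## §U  The NORM-FORM CLEARING `Q = U² − bUV + acV²` of the first variable at a quadratic point -/

section Clearing

variable {n : ℕ} (a b c : ℤ) (P : MvPolynomial (Fin (n + 1)) ℤ) (d : ℕ)

/-- `U = Σ_s coeff_s · a^{d−s₀} u_{s₀} · X^{tail s}` -/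
def Upol : MvPolynomial (Fin n) ℤ :=
  ∑ s ∈ P.support, monomial (Finsupp.tail s) (P.coeff s * a ^ (d - s 0) * useq a b c (s 0))

/-- `V = Σ_s coeff_s · a^{d−s₀} v_{s₀} · X^{tail s}` -/
def Vpol : MvPolynomial (Fin n) ℤ :=
  ∑ s ∈ P.support, monomial (Finsupp.tail s) (P.coeff s * a ^ (d - s 0) * vseq a b c (s 0))

/-- the NORM FORM `Q = U² − bUV + acV² ∈ ℤ[X₁..Xₙ]` (`= (U + γV)(U + γ′V)`, `γ = aβ`, `γ′` its conjugate) -/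
def Qpol : MvPolynomial (Fin n) ℤ :=
  Upol a b c P d * Upol a b c P d - C b * (Upol a b c P d * Vpol a b c P d) +
    C (a * c) * (Vpol a b c P d * Vpol a b c P d)

/-- `U(θ) + (aβ)·V(θ) = a^d · P(β, θ)` at a root `β` of `aZ² + bZ + c`. -/
theorem aeval_U_add_mul_V (θ : Fin n → ℂ) {β : ℂ} (hβ : (a : ℂ) * β ^ 2 + b * β + c = 0)
    (hd : ∀ s ∈ P.support, s 0 ≤ d) :
    aeval θ (Upol a b c P d) + ((a : ℂ) * β) * aeval θ (Vpol a b c P d) =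
      (a : ℂ) ^ d * aeval (Fin.cons β θ : Fin (n + 1) → ℂ) P := by
  have hγ : ((a : ℂ) * β) ^ 2 + (b : ℂ) * ((a : ℂ) * β) + (a : ℂ) * (c : ℂ) = 0 := by
    linear_combination (a : ℂ) * hβ
  unfold Upol Vpol
  rw [map_sum, map_sum, Finset.mul_sum, ← Finset.sum_add_distrib]
  conv_rhs => rw [MvPolynomial.aeval_def, MvPolynomial.eval₂_eq', Finset.mul_sum]
  refine Finset.sum_congr rfl fun s hs => ?_
  rw [MvPolynomial.aeval_monomial, MvPolynomial.aeval_monomial, algebraMap_int_eq, eq_intCast, eq_intCast,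
    Finsupp.prod_fintype _ _ (fun _ => by simp), Fin.prod_univ_succ]
  simp only [Finsupp.tail_apply, Fin.cons_zero, Fin.cons_succ, Int.cast_mul, Int.cast_pow, eq_intCast]
  have hk := pow_eq_uv a b c ((a : ℂ) * β) hγ (s 0)
  have hsplit : (a : ℂ) ^ d = (a : ℂ) ^ (d - s 0) * (a : ℂ) ^ (s 0) := by
    rw [← pow_add, Nat.sub_add_cancel (hd s hs)]
  rw [hsplit]
  linear_combination (-(((P.coeff s : ℤ) : ℂ) * (a : ℂ) ^ (d - s 0) * ∏ j, θ j ^ (s j.succ))) * hk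

/-- `Q(θ) = (U(θ) + γ V(θ)) · (U(θ) + γ′ V(θ))` for a root `γ` of `Z² + bZ + ac`, `γ′ = −b − γ`. -/
theorem aeval_Qpol (θ : Fin n → ℂ) {γ : ℂ} (hγ : γ ^ 2 + (b : ℂ) * γ + (a : ℂ) * (c : ℂ) = 0) :
    aeval θ (Qpol a b c P d) = (aeval θ (Upol a b c P d) + γ * aeval θ (Vpol a b c P d)) *
      (aeval θ (Upol a b c P d) + (-(b : ℂ) - γ) * aeval θ (Vpol a b c P d)) := by
  unfold Qpol
  simp only [map_add, map_sub, map_mul, map_intCast, eq_intCast]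
  linear_combination (aeval θ (Vpol a b c P d)) ^ 2 * hγ

/-- the `X^{s'}`-coefficients: `U_{s'} + (aβ) V_{s'} = a^d g_{s'}(β)` -/
theorem coeff_U_add_mul_V (s' : Fin n →₀ ℕ) {β : ℂ} (hβ : (a : ℂ) * β ^ 2 + b * β + c = 0)
    (hd : ∀ s ∈ P.support, s 0 ≤ d) :
    (((Upol a b c P d).coeff s' : ℤ) : ℂ) + ((a : ℂ) * β) * (((Vpol a b c P d).coeff s' : ℤ) : ℂ) =
      (a : ℂ) ^ d * ((gcoef P s').map (Int.castRingHom ℂ)).eval β := by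
  classical
  have hγ : ((a : ℂ) * β) ^ 2 + (b : ℂ) * ((a : ℂ) * β) + (a : ℂ) * (c : ℂ) = 0 := by
    linear_combination (a : ℂ) * hβ
  unfold Upol Vpol gcoef
  rw [MvPolynomial.coeff_sum, MvPolynomial.coeff_sum, Int.cast_sum, Int.cast_sum, Polynomial.eval_map,
    Polynomial.eval₂_finsetSum, Finset.mul_sum, Finset.mul_sum, ← Finset.sum_add_distrib,
    ← Finset.sum_filter_add_sum_filter_not P.support (fun s => Finsupp.tail s = s')]
  rw [Finset.sum_eq_zero (s := P.support.filter fun s => ¬ Finsupp.tail s = s') (fun s hs => by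
        rw [MvPolynomial.coeff_monomial, MvPolynomial.coeff_monomial, if_neg (Finset.mem_filter.mp hs).2,
          if_neg (Finset.mem_filter.mp hs).2, Int.cast_zero, mul_zero, add_zero]), add_zero]
  refine Finset.sum_congr rfl fun s hs => ?_
  rw [MvPolynomial.coeff_monomial, MvPolynomial.coeff_monomial, if_pos (Finset.mem_filter.mp hs).2,
    if_pos (Finset.mem_filter.mp hs).2, Polynomial.eval₂_monomial]
  simp only [Int.cast_mul, Int.cast_pow, eq_intCast]
  have hk := pow_eq_uv a b c ((a : ℂ) * β) hγ (s 0)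
  have hsplit : (a : ℂ) ^ d = (a : ℂ) ^ (d - s 0) * (a : ℂ) ^ (s 0) := by
    rw [← pow_add, Nat.sub_add_cancel (hd s (Finset.mem_filter.mp hs).1)]
  rw [hsplit]
  linear_combination (-(((P.coeff s : ℤ) : ℂ) * (a : ℂ) ^ (d - s 0))) * hk

/-- `U`, `V` have total degree `≤ P.totalDegree`. -/
theorem totalDegree_UV_le :
    (Upol a b c P d).totalDegree ≤ P.totalDegree ∧ (Vpol a b c P d).totalDegree ≤ P.totalDegree := by
  have key : ∀ (w : (Fin (n + 1) →₀ ℕ) → ℤ),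
      (∑ s ∈ P.support, monomial (Finsupp.tail s) (w s)).totalDegree ≤ P.totalDegree := by
    intro w
    refine totalDegree_finsetSum_le fun s hs => ?_
    refine (totalDegree_monomial_le _ _).trans ?_
    refine le_trans ?_ (le_totalDegree hs)
    rw [Finsupp.sum_fintype _ _ (fun _ => rfl), Finsupp.sum_fintype _ _ (fun _ => rfl),
      Fin.sum_univ_succ]
    simp only [Finsupp.tail_apply, id]
    omega
  exact ⟨key _, key _⟩

/-- `Q` has total degree `≤ 2 · P.totalDegree`. -/
theorem totalDegree_Qpol_le : (Qpol a b c P d).totalDegree ≤ 2 * P.totalDegree := by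
  obtain ⟨hU, hV⟩ := totalDegree_UV_le a b c P d
  unfold Qpol
  refine (totalDegree_add _ _).trans (max_le ((totalDegree_sub _ _).trans (max_le ?_ ?_)) ?_)
  · exact (totalDegree_mul _ _).trans (by omega)
  · refine (totalDegree_mul _ _).trans ?_
    have := totalDegree_C (b : ℤ) (σ := Fin n)
    have h2 := totalDegree_mul (Upol a b c P d) (Vpol a b c P d)
    omega
  · refine (totalDegree_mul _ _).trans ?_
    have := totalDegree_C (a * c : ℤ) (σ := Fin n)
    have h2 := totalDegree_mul (Vpol a b c P d) (Vpol a b c P d)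
    omega

/-- `mvlen` of a monomial. -/
theorem mvlen_monomial_le (s : Fin n →₀ ℕ) (r : ℤ) : mvlen (monomial s r) ≤ |r| := by
  classical
  unfold mvlen
  rw [MvPolynomial.support_monomial]
  split_ifs with h
  · simp [h]
  · simp [MvPolynomial.coeff_monomial]

/-- heights: `mvlen U, mvlen V ≤ mvlen P · (2A²)^d` -/
theorem mvlen_UV_le {A : ℤ} (hA : 1 ≤ A) (ha : |a| ≤ A) (hb : |b| ≤ A) (hc : |c| ≤ A)
    (hd : ∀ s ∈ P.support, s 0 ≤ d) :
    mvlen (Upol a b c P d) ≤ mvlen P * (2 * A * A) ^ d ∧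
      mvlen (Vpol a b c P d) ≤ mvlen P * (2 * A * A) ^ d := by
  have hW1 : (1 : ℤ) ≤ 2 * A * A := by nlinarith
  have key : ∀ (w : ℕ → ℤ), (∀ k, |w k| ≤ (2 * A * A) ^ k) →
      mvlen (∑ s ∈ P.support, monomial (Finsupp.tail s) (P.coeff s * a ^ (d - s 0) * w (s 0))) ≤
        mvlen P * (2 * A * A) ^ d := by
    intro w hw
    refine (mvlen_sum_le _ _).trans ?_
    calc ∑ s ∈ P.support, mvlen (monomial (Finsupp.tail s) (P.coeff s * a ^ (d - s 0) * w (s 0)))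
        ≤ ∑ s ∈ P.support, |P.coeff s| * (2 * A * A) ^ d := Finset.sum_le_sum fun s hs => by
          refine (mvlen_monomial_le _ _).trans ?_
          rw [abs_mul, abs_mul, abs_pow, mul_assoc]
          refine mul_le_mul_of_nonneg_left ?_ (abs_nonneg _)
          calc |a| ^ (d - s 0) * |w (s 0)| ≤ (2 * A * A) ^ (d - s 0) * (2 * A * A) ^ (s 0) :=
              mul_le_mul (pow_le_pow_left₀ (abs_nonneg _) (by nlinarith [abs_nonneg a]) _) (hw _)
                (abs_nonneg _) (pow_nonneg (by nlinarith) _)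
            _ = (2 * A * A) ^ d := by rw [← pow_add, Nat.sub_add_cancel (hd s hs)]
      _ = mvlen P * (2 * A * A) ^ d := by rw [← Finset.sum_mul]; rfl
  exact ⟨key (useq a b c) fun k => (abs_uv_le a b c hA ha hb hc k).1,
    key (vseq a b c) fun k => (abs_uv_le a b c hA ha hb hc k).2⟩

/-- the height of `Q`: `mvlen Q ≤ 3A² (mvlen P)² (2A²)^{2d}` -/
theorem mvlen_Qpol_le {A : ℤ} (hA : 1 ≤ A) (ha : |a| ≤ A) (hb : |b| ≤ A) (hc : |c| ≤ A)
    (hd : ∀ s ∈ P.support, s 0 ≤ d) :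
    mvlen (Qpol a b c P d) ≤ 3 * A * A * (mvlen P * (2 * A * A) ^ d) ^ 2 := by
  obtain ⟨hU, hV⟩ := mvlen_UV_le a b c P d hA ha hb hc hd
  set M : ℤ := mvlen P * (2 * A * A) ^ d with hM
  have hU0 : 0 ≤ mvlen (Upol a b c P d) := mvlen_nonneg _
  have hV0 : 0 ≤ mvlen (Vpol a b c P d) := mvlen_nonneg _
  have hM0 : 0 ≤ M := le_trans hU0 hU
  have h1 : mvlen (Upol a b c P d * Upol a b c P d) ≤ M * M :=
    (mvlen_mul_le _ _).trans (mul_le_mul hU hU hU0 hM0)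
  have h2 : mvlen (C b * (Upol a b c P d * Vpol a b c P d)) ≤ A * (M * M) :=
    (mvlen_C_mul_le _ _).trans (mul_le_mul hb ((mvlen_mul_le _ _).trans (mul_le_mul hU hV hV0 hM0))
      (mvlen_nonneg _) (le_trans zero_le_one hA))
  have h3 : mvlen (C (a * c) * (Vpol a b c P d * Vpol a b c P d)) ≤ A * A * (M * M) := by
    refine (mvlen_C_mul_le _ _).trans (mul_le_mul ?_ ((mvlen_mul_le _ _).trans (mul_le_mul hV hV hV0 hM0))
      (mvlen_nonneg _) (by nlinarith))
    rw [abs_mul]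
    exact mul_le_mul ha hc (abs_nonneg _) (le_trans zero_le_one hA)
  unfold Qpol
  calc mvlen (Upol a b c P d * Upol a b c P d - C b * (Upol a b c P d * Vpol a b c P d) +
        C (a * c) * (Vpol a b c P d * Vpol a b c P d))
      ≤ mvlen (Upol a b c P d * Upol a b c P d - C b * (Upol a b c P d * Vpol a b c P d)) +
          mvlen (C (a * c) * (Vpol a b c P d * Vpol a b c P d)) := mvlen_add_le _ _
    _ ≤ (M * M + A * (M * M)) + A * A * (M * M) :=
        add_le_add ((mvlen_sub_le _ _).trans (add_le_add h1 h2)) h3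
    _ = (1 + A + A * A) * (M * M) := by ring
    _ ≤ (3 * A * A) * (M * M) := mul_le_mul_of_nonneg_right (by nlinarith) (mul_nonneg hM0 hM0)
    _ = 3 * A * A * M ^ 2 := by ring

/-- NONVANISHING of a factor: if `U_{s} + γ V_{s} = 0` for all `s` with `γ` real irrational, then `U = V = 0`. -/
theorem UV_eq_zero_of_coeff {γ : ℝ} (hγ : Irrational γ)
    (h : ∀ s, (((Upol a b c P d).coeff s : ℤ) : ℂ) + (γ : ℂ) * (((Vpol a b c P d).coeff s : ℤ) : ℂ) = 0) :
    Upol a b c P d = 0 ∧ Vpol a b c P d = 0 := by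
  have key : ∀ s, (Upol a b c P d).coeff s = 0 ∧ (Vpol a b c P d).coeff s = 0 := by
    intro s
    have h1 : (((Upol a b c P d).coeff s : ℤ) : ℝ) + γ * (((Vpol a b c P d).coeff s : ℤ) : ℝ) = 0 := by
      have := h s
      exact_mod_cast this
    set u : ℤ := (Upol a b c P d).coeff s
    set v : ℤ := (Vpol a b c P d).coeff s
    by_cases hv : v = 0
    · rw [hv, Int.cast_zero, mul_zero, add_zero] at h1
      exact ⟨by exact_mod_cast h1, hv⟩
    · exfalso
      have hvR : (v : ℝ) ≠ 0 := by exact_mod_cast hv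
      have hγeq : γ = ((-u / v : ℚ) : ℝ) := by
        push_cast
        field_simp
        linarith
      exact hγ ⟨-u / v, hγeq.symm⟩
  exact ⟨MvPolynomial.ext _ _ fun s => by rw [(key s).1, MvPolynomial.coeff_zero],
    MvPolynomial.ext _ _ fun s => by rw [(key s).2, MvPolynomial.coeff_zero]⟩

end Clearing

end Summit.Schanuel.Schanuel.Theorems.RootDecomp1BQuadFrame

end
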